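import Mathlib.Analysis.Complex.Basic
import Mathlib.Analysis.Calculus.Deriv.Star
import Mathlib.MeasureTheory.Measure.Lebesgue.Basic
import Mathlib.MeasureTheory.Function.L2Space
import Mathlib.MeasureTheory.Integral.Bochner.ContinuousLinearMap
import HarnessLib

/-!
# de Branges spaces `𝓗(E)` of entire functions

The vocabulary of L. de Branges' theory of Hilbert spaces of entire functions, in the form used
by the Riemann-hypothesis literature (Conrey–Li 2000, §2) and by the spectral theory of canonical
systems (Romanov 2014, §13):

* `sharp F`, the conjugate reflection `F♯(z) = conj (F (conj z))` (de Branges' `F*`, Conrey–Li's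
  `\bar F(\bar z)`);
* `IsHermiteBiehler E`: `E` is entire and `‖E (conj z)‖ < ‖E z‖` for `Im z > 0` (a
  Hermite–Biehler, or de Branges, function) [Romanov2014, Introduction; ConreyLi2000, §2];
* `deBrangesKernel E w z = (E z · conj (E w) − E♯ z · conj (E♯ w)) / (2πi (conj w − z))`, the
  kernel `K(w, z)` of `𝓗(E)` [ConreyLi2000, §2], and its diagonal in closed form
  `deBrangesKernelDiag E z = (‖E z‖² − ‖E (conj z)‖²) / (4π Im z)` (`= K(z, z)` for `Im z ≠ 0`,
  `deBrangesKernel_self`);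
* `deBrangesNormSq E F = ∫ ‖F x / E x‖² dx` and
  `deBrangesInner E F G = ∫ F x · conj (G x) / ‖E x‖² dx`, the norm and scalar product of `𝓗(E)`
  [ConreyLi2000, §2];
* `HasKernelBound E F`: the pointwise inequality `‖F z‖² ≤ ‖F‖² K(z, z)` of Conrey–Li's
  definition (2.1), imposed at every non-real `z`;
* `DeBrangesSpace E : Submodule ℂ (ℂ → ℂ)`, the de Branges space `𝓗(E)` as a linear space of
  entire functions: `F` entire, `F/E ∈ L²(ℝ)`, and `‖F z‖² ≤ C · K(z, z)` at every non-real `z`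
  for some constant `C` — the pointwise characterization of `𝓗(E)` [Romanov2014, §13 Lemma 15],
  whose modern definition is `F/E, F♯/E ∈ H²(ℂ₊)` [Romanov2014, §13 Definition 4].

## Sources (read)

* [ConreyLi2000] J. B. Conrey, X.-J. Li, *A note on some positivity conditions related to zeta and
  L-functions*, IMRN 2000:18, 929–940 = arXiv:math/9812166, §2: definition of `𝓗(E)` with (2.1),
  scalar product, kernel `K(w, z)`, reproducing identity (2.2), Theorem 1.
* [Romanov2014] R. Romanov, *Canonical systems and de Branges spaces*, arXiv:1408.6022,
  Introduction (HB functions), §3 proof of Thm. 5 (kernel formula), §13 Definition 4, Lemma 15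
  (pointwise characterization, with proof), Theorem 19 (axiomatic characterization).

## Design choices

* Membership is Romanov's pointwise characterization (Lemma 15: `f ∈ L²(ℝ, |E|⁻²)` and
  `|f(z)| ≤ C_f √((|E(z)|² − |E(z̄)|²)/Im z)`), squared and written with `deBrangesKernelDiag`
  (`(|E(z)|² − |E(z̄)|²)/Im z = 4π · K(z,z)`), because it is elementary (Mathlib has no Hardy space
  `H²(ℂ₊)`) and visibly closed under linear combinations, so `𝓗(E)` is an honest `Submodule`.
  Conrey–Li's definition (2.1) uses the sharp constant `C = ‖F‖²`; that every element satisfies the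
  sharp bound is the reproducing-kernel property ((2.2) and Cauchy–Schwarz), a theorem of the
  theory which is not proved here. The sharp inequality is recorded separately as
  `HasKernelBound`, and `mem_of_hasKernelBound` embeds Conrey–Li's (2.1)-members into
  `DeBrangesSpace E`.
* The pointwise inequality is imposed for `Im z ≠ 0` only, where `K(z, z)` has the closed form
  `deBrangesKernelDiag`; on the real axis `K(x, x)` is a limit and (2.1) there follows by
  continuity, so nothing is lost (Conrey–Li state (2.1) "for all complex `z`").
* `F/E ∈ L²(ℝ)` is `MemLp (fun x : ℝ ↦ F x / E x) 2 volume`; for entire `E`, `F` this is the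
  integrability of `‖F x / E x‖²` (`memLp_two_iff_integrable_normSq`), the form transcribed in
  route statements.
* Junk values. All definitions take an arbitrary `E : ℂ → ℂ`; they carry their intended meaning
  when `IsHermiteBiehler E` (then `deBrangesKernelDiag E z > 0` off the real axis,
  `IsHermiteBiehler.deBrangesKernelDiag_pos`). Lean's `x / 0 = 0` makes `deBrangesKernel E w z = 0`
  when `conj w = z` and `deBrangesKernelDiag E x = 0` for real `x`; neither value is used.

## Not here (deliberately)

The Hilbert-space structure of `𝓗(E)` (completeness; `deBrangesInner` as its inner product), the
facts that `K(w, ·) ∈ 𝓗(E)` and `F(w) = ⟨F, K(w, ·)⟩` [ConreyLi2000, (2.2)], the equivalence of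
`DeBrangesSpace` with the `H²` definition and with the sharp bound (2.1), de Branges' axiomatic
characterization [Romanov2014, Thm. 19], and de Branges' positivity theorem [ConreyLi2000, Thm. 1]
are results about these objects, to be vendored separately as theorems or named facts.
-/

noncomputable section

open scoped ComplexConjugate Real
open _root_.Complex _root_.MeasureTheory

namespace Literature.Analysis.DeBrangesSpaces

/-! ## Conjugate reflection -/

/-- The conjugate reflection `F♯(z) = conj (F (conj z))` of a function `F : ℂ → ℂ` (de Branges'
`F*(z) = \bar F(\bar z)`; Romanov's `f*`). For entire `F` it is entire, and `F♯ = F` on `ℝ` iff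
`F` is real on `ℝ`. [folklore] -/
def sharp (F : ℂ → ℂ) : ℂ → ℂ := fun z ↦ conj (F (conj z))

/-- Unfolding `sharp`. [folklore] -/
@[simp] theorem sharp_apply (F : ℂ → ℂ) (z : ℂ) : sharp F z = conj (F (conj z)) := rfl

/-- `♯` is an involution. [folklore] -/
@[simp] theorem sharp_sharp (F : ℂ → ℂ) : sharp (sharp F) = F := by
  funext z; simp [sharp]

/-- On the real axis `F♯(x) = conj (F x)`. [folklore] -/
theorem sharp_ofReal (F : ℂ → ℂ) (x : ℝ) : sharp F x = conj (F x) := by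
  simp [sharp, Complex.conj_ofReal]

/-- `‖F♯(z)‖ = ‖F(conj z)‖`. [folklore] -/
@[simp] theorem norm_sharp (F : ℂ → ℂ) (z : ℂ) : ‖sharp F z‖ = ‖F (conj z)‖ := by
  simp [sharp]

/-- The conjugate reflection of an entire function is entire. [folklore] -/
theorem differentiable_sharp {F : ℂ → ℂ} (hF : Differentiable ℂ F) :
    Differentiable ℂ (sharp F) := by
  intro z
  have h := (hF (conj z)).conj_conj
  rw [Complex.conj_conj] at h
  exact h

/-! ## Hermite–Biehler (de Branges) functions -/

/-- **Hermite–Biehler function** (de Branges structure function): an entire function `E` with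
`‖E (conj z)‖ < ‖E z‖` for every `z` in the open upper half-plane. This is the standing
hypothesis under which de Branges' space `𝓗(E)` is defined ("Let `E(z)` be an entire function
satisfying `|E(z̄)| < |E(z)|` for `z` in the upper half-plane", Conrey–Li §2; "an Hermite–Biehler
(HB) function, that is, an entire function satisfying `|E(z)| > |E(z̄)|` for `z ∈ ℂ₊`", Romanov).
[cite: Romanov2014, Introduction] [cite: ConreyLi2000, §2] -/
structure IsHermiteBiehler (E : ℂ → ℂ) : Prop where
  /-- `E` is entire. -/
  differentiable : Differentiable ℂ E
  /-- `‖E(z̄)‖ < ‖E(z)‖` on the open upper half-plane. -/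
  norm_conj_lt : ∀ z : ℂ, 0 < z.im → ‖E (conj z)‖ < ‖E z‖

namespace IsHermiteBiehler

variable {E : ℂ → ℂ}

/-- A Hermite–Biehler function has no zeros in the open upper half-plane. [folklore] -/
theorem ne_zero_of_im_pos (hE : IsHermiteBiehler E) {z : ℂ} (hz : 0 < z.im) : E z ≠ 0 := by
  intro h
  have hlt := hE.norm_conj_lt z hz
  rw [h, norm_zero] at hlt
  exact absurd hlt (not_lt.mpr (norm_nonneg _))

/-- `‖E♯(z)‖ < ‖E(z)‖` on the open upper half-plane. [folklore] -/
theorem norm_sharp_lt (hE : IsHermiteBiehler E) {z : ℂ} (hz : 0 < z.im) : ‖sharp E z‖ < ‖E z‖ := by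
  rw [norm_sharp]
  exact hE.norm_conj_lt z hz

end IsHermiteBiehler

/-! ## The kernel, the norm and the scalar product of `𝓗(E)` -/

/-- **The kernel of `𝓗(E)`**:
`K(w, z) = (E(z) conj E(w) − E♯(z) conj E♯(w)) / (2πi (conj w − z))` (Conrey–Li write
`\bar E(\bar z) E(\bar w)` for the second product, which is `E♯(z) conj E♯(w)`). It is the
reproducing kernel of `𝓗(E)`: `F(w) = ⟨F, K(w, ·)⟩` for `F ∈ 𝓗(E)` (Conrey–Li (2.2), not proved
here). Junk value `0` when `conj w = z` (Lean's `x / 0 = 0`); on the diagonal off the real axis it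
equals `deBrangesKernelDiag` (`deBrangesKernel_self`). [cite: ConreyLi2000, §2] -/
def deBrangesKernel (E : ℂ → ℂ) (w z : ℂ) : ℂ :=
  (E z * conj (E w) - sharp E z * conj (sharp E w)) / (2 * π * I * (conj w - z))

/-- **The kernel on the diagonal**, in closed real form:
`K(z, z) = (‖E z‖² − ‖E (conj z)‖²) / (4π Im z)` for `Im z ≠ 0` (from Conrey–Li's `K(w, z)` with
`w = z`, `2πi (z̄ − z) = 4π Im z`). Junk value `0` on the real axis (where the true `K(x, x)` is the
limit of this expression). [cite: ConreyLi2000, §2] -/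
def deBrangesKernelDiag (E : ℂ → ℂ) (z : ℂ) : ℝ :=
  (‖E z‖ ^ 2 - ‖E (conj z)‖ ^ 2) / (4 * π * z.im)

/-- **The `𝓗(E)` norm squared**: `‖F‖²_{𝓗(E)} = ∫ ‖F(x)/E(x)‖² dx` over the real axis
(Bochner integral; junk value `0` if not integrable). [cite: ConreyLi2000, §2] -/
def deBrangesNormSq (E F : ℂ → ℂ) : ℝ :=
  ∫ x : ℝ, ‖F x / E x‖ ^ 2

/-- **The `𝓗(E)` scalar product**: `⟨F, G⟩_{𝓗(E)} = ∫ F(x) conj G(x) / ‖E(x)‖² dx` over the real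
axis, linear in the first variable (Bochner integral; junk value `0` if not integrable).
[cite: ConreyLi2000, §2] -/
def deBrangesInner (E F G : ℂ → ℂ) : ℂ :=
  ∫ x : ℝ, F x * conj (G x) / ((‖E x‖ : ℂ) ^ 2)

/-- Hermitian symmetry of the kernel: `conj K(w, z) = K(z, w)` (an algebraic identity, valid for
every `E`, including at the junk value). [folklore] -/
theorem conj_deBrangesKernel (E : ℂ → ℂ) (w z : ℂ) :
    conj (deBrangesKernel E w z) = deBrangesKernel E z w := by
  unfold deBrangesKernel
  rw [map_div₀]
  have hden : conj (2 * (π : ℂ) * I * (conj w - z)) = 2 * (π : ℂ) * I * (conj z - w) := by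
    simp only [map_mul, map_sub, Complex.conj_conj, Complex.conj_ofReal, Complex.conj_I, map_ofNat]
    ring
  have hnum : conj (E z * conj (E w) - sharp E z * conj (sharp E w)) =
      E w * conj (E z) - sharp E w * conj (sharp E z) := by
    simp only [map_mul, map_sub, Complex.conj_conj]
    ring
  rw [hden, hnum]

/-- `K(z, z) = (‖E z‖² − ‖E z̄‖²) / (4π Im z)`: the kernel on the diagonal is the real number
`deBrangesKernelDiag E z` (both sides are the junk value `0` on the real axis). [folklore] -/
theorem deBrangesKernel_self (E : ℂ → ℂ) (z : ℂ) :
    deBrangesKernel E z z = (deBrangesKernelDiag E z : ℂ) := by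
  have hden : 2 * (π : ℂ) * I * (conj z - z) = ((4 * π * z.im : ℝ) : ℂ) := by
    have h1 : conj z - z = -((2 * z.im : ℝ) * I) := by
      rw [← Complex.sub_conj]; ring
    rw [h1]
    push_cast
    ring_nf
    rw [Complex.I_sq]
    ring
  unfold deBrangesKernel deBrangesKernelDiag
  rw [Complex.mul_conj', Complex.mul_conj', norm_sharp, hden]
  push_cast
  ring

/-- `K(z̄, z̄) = K(z, z)`: the diagonal of the kernel is symmetric under conjugation (valid for
every `E`). [folklore] -/
theorem deBrangesKernelDiag_conj (E : ℂ → ℂ) (z : ℂ) :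
    deBrangesKernelDiag E (conj z) = deBrangesKernelDiag E z := by
  simp only [deBrangesKernelDiag, Complex.conj_conj, Complex.conj_im]
  rw [← neg_sub (‖E z‖ ^ 2), mul_neg, neg_div_neg_eq]

/-- For a Hermite–Biehler function the kernel diagonal is strictly positive off the real axis:
`K(z, z) > 0` for `Im z ≠ 0`. [folklore] -/
theorem IsHermiteBiehler.deBrangesKernelDiag_pos {E : ℂ → ℂ} (hE : IsHermiteBiehler E) {z : ℂ}
    (hz : z.im ≠ 0) : 0 < deBrangesKernelDiag E z := by
  rcases lt_or_gt_of_ne hz with hneg | hpos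
  · -- lower half-plane: apply the Hermite–Biehler inequality at `conj z`
    have hlt : ‖E z‖ < ‖E (conj z)‖ := by
      have := hE.norm_conj_lt (conj z) (by simpa using hneg)
      simpa using this
    have hnum : ‖E z‖ ^ 2 - ‖E (conj z)‖ ^ 2 < 0 := by
      have := pow_lt_pow_left₀ hlt (norm_nonneg _) two_ne_zero
      linarith
    have hden : 4 * π * z.im < 0 := by
      have : 0 < 4 * π := by positivity
      nlinarith
    exact div_pos_of_neg_of_neg hnum hden
  · have hlt := hE.norm_conj_lt z hpos
    have hnum : 0 < ‖E z‖ ^ 2 - ‖E (conj z)‖ ^ 2 := by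
      have := pow_lt_pow_left₀ hlt (norm_nonneg _) two_ne_zero
      linarith
    have hden : 0 < 4 * π * z.im := by positivity
    exact div_pos hnum hden

/-- The norm squared is non-negative. [folklore] -/
theorem deBrangesNormSq_nonneg (E F : ℂ → ℂ) : 0 ≤ deBrangesNormSq E F :=
  integral_nonneg fun x ↦ sq_nonneg ‖F x / E x‖

/-- `⟨F, F⟩_{𝓗(E)} = ‖F‖²_{𝓗(E)}`. [folklore] -/
theorem deBrangesInner_self (E F : ℂ → ℂ) :
    deBrangesInner E F F = (deBrangesNormSq E F : ℂ) := by
  have h : ∀ x : ℝ, F x * conj (F x) / ((‖E x‖ : ℂ) ^ 2) = ((‖F x / E x‖ ^ 2 : ℝ) : ℂ) := by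
    intro x
    rw [Complex.mul_conj', norm_div, div_pow]
    push_cast
    ring
  unfold deBrangesInner deBrangesNormSq
  simp_rw [h]
  exact integral_ofReal

/-- `‖F♯‖_{𝓗(E)} = ‖F‖_{𝓗(E)}` (on the real axis `‖F♯(x)/E(x)‖ = ‖F(x)/E(x)‖`). [folklore] -/
theorem deBrangesNormSq_sharp (E F : ℂ → ℂ) :
    deBrangesNormSq E (sharp F) = deBrangesNormSq E F := by
  unfold deBrangesNormSq
  congr 1
  funext x
  rw [norm_div, norm_div, sharp_ofReal, Complex.norm_conj]

/-- For entire `E` and `F`, `F/E ∈ L²(ℝ)` (as `MemLp … 2`) iff `‖F x / E x‖²` is integrable on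
`ℝ` — the form in which route statements transcribe square-integrability. [folklore] -/
theorem memLp_two_iff_integrable_normSq {E F : ℂ → ℂ} (hE : Differentiable ℂ E)
    (hF : Differentiable ℂ F) :
    MemLp (fun x : ℝ ↦ F x / E x) 2 volume ↔ Integrable (fun x : ℝ ↦ ‖F x / E x‖ ^ 2) := by
  refine memLp_two_iff_integrable_sq_norm ?_
  exact ((hF.continuous.measurable.comp Complex.measurable_ofReal).div
    (hE.continuous.measurable.comp Complex.measurable_ofReal)).aestronglyMeasurable

/-! ## The space `𝓗(E)` -/

/-- **Conrey–Li's inequality (2.1)**: `‖F(z)‖² ≤ ‖F‖²_{𝓗(E)} K(z, z)`, imposed at every non-real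
`z` (where `K(z, z) = deBrangesKernelDiag E z`; at real points it follows by continuity).
Conrey–Li *define* `𝓗(E)` as the entire `F` with `F/E ∈ L²(ℝ)` satisfying this inequality; for
elements of `DeBrangesSpace E` it is the reproducing-kernel property (2.2) with Cauchy–Schwarz,
a theorem not proved in this file (see `mem_of_hasKernelBound` for the elementary direction).
[cite: ConreyLi2000, §2 (2.1)] -/
def HasKernelBound (E F : ℂ → ℂ) : Prop :=
  ∀ z : ℂ, z.im ≠ 0 → ‖F z‖ ^ 2 ≤ deBrangesNormSq E F * deBrangesKernelDiag E z

/-- **The de Branges space `𝓗(E)`** of a (Hermite–Biehler) function `E`, as a `ℂ`-linear space of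
entire functions: `F ∈ 𝓗(E)` iff `F` is entire, `F/E ∈ L²(ℝ)`, and for some constant `C`,
`‖F(z)‖² ≤ C · K(z, z)` at every non-real `z`, `K(z, z) = (‖E z‖² − ‖E z̄‖²)/(4π Im z)`. This is
the pointwise characterization of `𝓗(E)` — Romanov, Lemma 15: an entire `f` lies in `𝓗(E)` iff
`f ∈ L²(ℝ, |E|⁻² dt)` and `|f(z)| ≤ C_f √((|E(z)|² − |E(z̄)|²)/Im z)` — of the space defined by
`f/E, f♯/E ∈ H²(ℂ₊)` with the norm `‖f‖ = ‖f/E‖_{L²(ℝ)}` (Romanov, Definition 4); Conrey–Li's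
definition is the same with the sharp constant `C = ‖F‖²` ((2.1), `HasKernelBound`). The norm and
scalar product are `deBrangesNormSq E`, `deBrangesInner E`; the Hilbert-space structure and the
reproducing kernel `deBrangesKernel E` (Conrey–Li (2.2)) are not constructed here. Named after the
space like `MeasureTheory.Lp`; use `F ∈ DeBrangesSpace E` or the coerced type. For `E` not
Hermite–Biehler the definition is not meaningful (junk). [cite: Romanov2014, §13 Lemma 15]
[cite: ConreyLi2000, §2 (2.1)] -/
def DeBrangesSpace (E : ℂ → ℂ) : Submodule ℂ (ℂ → ℂ) where
  carrier := {F | Differentiable ℂ F ∧ MemLp (fun x : ℝ ↦ F x / E x) 2 volume ∧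
    ∃ C : ℝ, ∀ z : ℂ, z.im ≠ 0 → ‖F z‖ ^ 2 ≤ C * deBrangesKernelDiag E z}
  zero_mem' := by
    refine ⟨differentiable_const (0 : ℂ), ?_, 0, fun z _ ↦ by simp⟩
    simp only [Pi.zero_apply, zero_div]
    exact MemLp.zero'
  add_mem' := by
    rintro F G ⟨hF, hF2, C, hC⟩ ⟨hG, hG2, D, hD⟩
    refine ⟨hF.add hG, ?_, 2 * C + 2 * D, fun z hz ↦ ?_⟩
    · have h := hF2.add hG2
      convert h using 1
      funext x
      simp [add_div]
    · have h1 := hC z hz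
      have h2 := hD z hz
      have h3 : ‖F z + G z‖ ^ 2 ≤ (‖F z‖ + ‖G z‖) ^ 2 :=
        pow_le_pow_left₀ (norm_nonneg _) (norm_add_le _ _) 2
      calc ‖(F + G) z‖ ^ 2 = ‖F z + G z‖ ^ 2 := rfl
        _ ≤ 2 * ‖F z‖ ^ 2 + 2 * ‖G z‖ ^ 2 := by nlinarith [sq_nonneg (‖F z‖ - ‖G z‖)]
        _ ≤ 2 * (C * deBrangesKernelDiag E z) + 2 * (D * deBrangesKernelDiag E z) := by linarith
        _ = (2 * C + 2 * D) * deBrangesKernelDiag E z := by ring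
  smul_mem' := by
    rintro c F ⟨hF, hF2, C, hC⟩
    refine ⟨hF.const_smul c, ?_, ‖c‖ ^ 2 * C, fun z hz ↦ ?_⟩
    · have h := hF2.const_mul c
      convert h using 1
      funext x
      simp [mul_div_assoc]
    · calc ‖(c • F) z‖ ^ 2 = ‖c‖ ^ 2 * ‖F z‖ ^ 2 := by simp [mul_pow]
        _ ≤ ‖c‖ ^ 2 * (C * deBrangesKernelDiag E z) :=
          mul_le_mul_of_nonneg_left (hC z hz) (sq_nonneg _)
        _ = ‖c‖ ^ 2 * C * deBrangesKernelDiag E z := by ring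

namespace DeBrangesSpace

variable {E F : ℂ → ℂ}

/-- Unfolding membership in `𝓗(E)`. [folklore] -/
theorem mem_iff : F ∈ DeBrangesSpace E ↔ Differentiable ℂ F ∧
    MemLp (fun x : ℝ ↦ F x / E x) 2 volume ∧
    ∃ C : ℝ, ∀ z : ℂ, z.im ≠ 0 → ‖F z‖ ^ 2 ≤ C * deBrangesKernelDiag E z :=
  Iff.rfl

/-- Elements of `𝓗(E)` are entire. [folklore] -/
theorem differentiable_of_mem (hF : F ∈ DeBrangesSpace E) : Differentiable ℂ F :=
  (mem_iff.mp hF).1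

/-- Elements of `𝓗(E)` have `F/E ∈ L²(ℝ)`. [folklore] -/
theorem memLp_of_mem (hF : F ∈ DeBrangesSpace E) : MemLp (fun x : ℝ ↦ F x / E x) 2 volume :=
  (mem_iff.mp hF).2.1

/-- **Conrey–Li's (2.1)-members lie in `𝓗(E)`**: an entire `F` with `‖F/E‖²` integrable on `ℝ`
and `‖F(z)‖² ≤ ‖F‖² K(z, z)` off the real axis belongs to `DeBrangesSpace E` (take `C = ‖F‖²`).
This is the bridge from the transcription of Conrey–Li §2 used in route statements.
[cite: ConreyLi2000, §2 (2.1)] -/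
theorem mem_of_hasKernelBound (hE : Differentiable ℂ E) (hF : Differentiable ℂ F)
    (hi : Integrable (fun x : ℝ ↦ ‖F x / E x‖ ^ 2)) (hb : HasKernelBound E F) :
    F ∈ DeBrangesSpace E :=
  mem_iff.mpr ⟨hF, (memLp_two_iff_integrable_normSq hE hF).2 hi, deBrangesNormSq E F, hb⟩

/-- `𝓗(E)` is closed under the conjugate reflection `F ↦ F♯` (for entire `E`; this is axiom (ii)
of de Branges' axiomatic description of the spaces `𝓗(E)`, Romanov Thm. 19, together with
`deBrangesNormSq_sharp`). [cite: Romanov2014, §13 Theorem 19] -/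
theorem sharp_mem (hE : Differentiable ℂ E) (hF : F ∈ DeBrangesSpace E) :
    sharp F ∈ DeBrangesSpace E := by
  obtain ⟨hd, h2, C, hC⟩ := mem_iff.mp hF
  refine mem_iff.mpr ⟨differentiable_sharp hd, ?_, C, fun z hz ↦ ?_⟩
  · have hmeas : AEStronglyMeasurable (fun x : ℝ ↦ sharp F x / E x) volume :=
      (((differentiable_sharp hd).continuous.measurable.comp Complex.measurable_ofReal).div
        (hE.continuous.measurable.comp Complex.measurable_ofReal)).aestronglyMeasurable
    refine h2.of_le hmeas (Filter.Eventually.of_forall fun x ↦ ?_)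
    rw [norm_div, norm_div, sharp_ofReal, Complex.norm_conj]
  · have hz' : (conj z).im ≠ 0 := by simpa using hz
    have h := hC (conj z) hz'
    rw [deBrangesKernelDiag_conj] at h
    simpa [norm_sharp] using h

end DeBrangesSpace

end Literature.Analysis.DeBrangesSpaces
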